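import Literature.Analysis.Complex.SteinManifold
import Mathlib.Topology.Compactness.SigmaCompact
import HarnessLib

/-!
# Analytic polyhedra and `𝒪(M)`-convex exhaustions of holomorphically convex manifolds (Hörmander, Lemma 5.3.7)

Everything in this file is PROVED. It is the first, purely topological, step of the function theory
on an abstract Stein manifold in the sense of Fritzsche–Grauert
(`Literature.Analysis.Complex.IsSteinManifold`: connected, holomorphically spreadable,
holomorphically convex; `Literature/Analysis/Complex/SteinManifold.lean`), needed by every proof
of Grauert's Oka principle over such a base
(`Literature.Geometry.Kaehler.grauert_oka_exists_holomorphic`,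
`Literature/Geometry/Kaehler/GrauertOkaPrinciple.lean`: the exhaustion `W_m` of Leiterer, SCV IV,
Ch. II, 5.3.2 / 6.5.3, and the analytic polyhedra on which Grauert's induction runs). Only
holomorphic CONVEXITY is used (`Literature.Analysis.Complex.IsHolomorphicallyConvex`: the hull
`K̂ = holomorphicHull E M K` of a compact set is compact).

* `holomorphicHull_holomorphicHull` — `K̂` is `𝒪(M)`-convex: `(K̂)^ = K̂`.
* `exists_mdifferentiable_norm_lt_one_lt` — a point `y ∉ K̂` is separated from `K̂` by a global
  holomorphic function: `‖g‖ < 1` on `K̂`, `‖g y‖ > 1` (the definition of the hull, rescaled).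
* `IsHolomorphicallyConvex.exists_polyhedron_between` — **Hörmander's Lemma 5.3.7.** If `M` is
  holomorphically convex (Hausdorff, locally compact), `K ⊆ M` is compact and `U ⊇ K̂` is open,
  there are finitely many `f₁, …, f_N ∈ 𝒪(M)` and a compact `W ⊆ U` with `K̂ ⊆ W°`,
  `‖f_j‖ < 1` on `K̂`, and `{x ∈ W : ‖f_j x‖ ≤ 1 ∀ j} ⊆ W°`. Hence (`…exists_analyticPolyhedron`)
  the ANALYTIC POLYHEDRON `P = {x ∈ W° : ‖f_j x‖ < 1 ∀ j}` is an open neighbourhood of `K̂` with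
  `P̄ ⊆ {x ∈ W : ‖f_j x‖ ≤ 1 ∀ j}` compact and contained in `U` — Hörmander's proof: `K̂` has a
  compact neighbourhood `W ⊆ U`; every point of the compact "boundary" `W ∖ W°` lies outside `K̂`,
  so is separated from `K̂` by some `f` with `‖f‖ < 1` on `K̂`, `‖f‖ > 1` near the point;
  finitely many such `f` (Borel–Lebesgue) give a polyhedron missing `W ∖ W°`.
* `IsHolomorphicallyConvex.exists_compactExhaustion_holomorphicHull_eq` — a holomorphically
  convex, Hausdorff, locally compact, σ-compact `M` has a compact exhaustion `K₀ ⊆ K₁° ⊆ K₁ ⊆ ⋯`,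
  `⋃ K_n = M`, by `𝒪(M)`-CONVEX compacta `K̂_n = K_n` (Hörmander, p. 125, the remark used in the
  proof of Thm. 5.3.9: "from (α) in Definition 5.1.3 it follows that there exists a sequence of
  compact subsets `K_j` … `K̂_j = K_j` and `⋃ K_j = Ω`"): take hulls along a compact exhaustion,
  re-indexed so that each hull lies in the interior of the next member.
* `IsSteinManifold.exists_polyhedron_between`, `IsSteinManifold.exists_analyticPolyhedron`,
  `IsSteinManifold.exists_compactExhaustion_holomorphicHull_eq` — the same for Stein manifolds
  in the binder shape of the Oka-principle facts (`E` finite-dimensional, `M` Hausdorff with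
  countable basis, charted on `E`; local compactness and σ-compactness are then automatic,
  `locallyCompactSpace_of_chartedSpace`).

What is NOT here: that `P̄` (or `{x ∈ W : ‖f_j‖ ≤ 1}`) is itself `𝒪(M)`-convex, Bishop's
reduction of the number of inequalities (Hörmander, Lemma 5.3.8), and any function theory ON the
polyhedra (Theorem B, Oka–Weil) — those are the deep inputs of the Oka principle and are not
claimed.

## References

* L. Hörmander, *An Introduction to Complex Analysis in Several Variables*, 2nd ed. (1973),
  Def. 5.1.3 (α), Lemma 5.3.7, and p. 125 (proof of Thm. 5.3.9) [HormanderSCV1973].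
* K. Fritzsche, H. Grauert, *From Holomorphic Functions to Complex Manifolds*, GTM 213 (2002),
  Ch. V §1 (holomorphically convex, Stein manifolds) [FritzscheGrauert2002].
-/

noncomputable section

open scoped Manifold Topology
open Set Filter

namespace Literature.Analysis.Complex

variable {E : Type*} [NormedAddCommGroup E] [NormedSpace ℂ E]
  {M : Type*} [TopologicalSpace M] [ChartedSpace E M]

/-! ### The hull is `𝒪(M)`-convex; separation of outside points -/

/-- Unfolding lemma: a bound of `‖f‖` on `K` bounds `‖f‖` on `K̂`. [folklore] -/
theorem norm_le_of_mem_holomorphicHull {K : Set M} {x : M} (hx : x ∈ holomorphicHull E M K)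
    {f : M → ℂ} (hf : MDifferentiable 𝓘(ℂ, E) 𝓘(ℂ, ℂ) f) {C : ℝ} (hC : ∀ y ∈ K, ‖f y‖ ≤ C) :
    ‖f x‖ ≤ C :=
  hx f hf C hC

/-- The holomorphically convex hull is idempotent: `K̂` is `𝒪(M)`-convex.
[cite: HormanderSCV1973, Def. 5.1.3 (α) and §2.6 (properties of hulls)] -/
theorem holomorphicHull_holomorphicHull (K : Set M) :
    holomorphicHull E M (holomorphicHull E M K) = holomorphicHull E M K :=
  Subset.antisymm (fun _ hx f hf C hC => hx f hf C fun _ hy => hy f hf C hC)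
    (subset_holomorphicHull _)

/-- **Separation of a point outside the hull.** If `y ∉ K̂` there is a global holomorphic `g`
with `‖g‖ < 1` on `K̂` and `1 < ‖g y‖`: by definition some holomorphic `f` and bound `C` have
`‖f‖ ≤ C` on `K` but `‖f y‖ > C`; rescale `f` by a constant between `max C 0` and `‖f y‖` (if
`C < 0` then `K = ∅ = K̂` and a constant does it). [cite: HormanderSCV1973, proof of Lemma 5.3.7] -/
theorem exists_mdifferentiable_norm_lt_one_lt {K : Set M} {y : M}
    (hy : y ∉ holomorphicHull E M K) :
    ∃ g : M → ℂ, MDifferentiable 𝓘(ℂ, E) 𝓘(ℂ, ℂ) g ∧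
      (∀ z ∈ holomorphicHull E M K, ‖g z‖ < 1) ∧ 1 < ‖g y‖ := by
  simp only [holomorphicHull, mem_setOf_eq, not_forall, not_le, exists_prop] at hy
  obtain ⟨f, hf, C, hCK, hCy⟩ := hy
  by_cases hC : max C 0 < ‖f y‖
  · set m : ℝ := (max C 0 + ‖f y‖) / 2 with hm
    have hC0 : 0 ≤ max C 0 := le_max_right _ _
    have hm0 : 0 < m := by rw [hm]; linarith
    have hmC : max C 0 < m := by rw [hm]; linarith
    have hmy : m < ‖f y‖ := by rw [hm]; linarith
    refine ⟨fun z => ((m : ℂ)⁻¹) • f z, hf.const_smul _, fun z hz => ?_, ?_⟩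
    · have hzC : ‖f z‖ ≤ max C 0 :=
        hz f hf _ fun w hw => (hCK w hw).trans (le_max_left _ _)
      rw [norm_smul, norm_inv, Complex.norm_real, Real.norm_of_nonneg hm0.le,
        inv_mul_lt_iff₀ hm0]
      linarith
    · rw [norm_smul, norm_inv, Complex.norm_real, Real.norm_of_nonneg hm0.le,
        lt_inv_mul_iff₀ hm0]
      linarith
  · have hC0 : C < 0 := by
      by_contra h
      push Not at h
      exact hC (by rwa [max_eq_left h])
    have hKe : K = ∅ :=
      eq_empty_of_forall_notMem fun z hz => by linarith [norm_nonneg (f z), hCK z hz]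
    subst hKe
    refine ⟨fun _ => 2, mdifferentiable_const, fun z hz => ?_, by norm_num⟩
    rw [holomorphicHull_empty] at hz
    exact hz.elim

/-! ### Hörmander's Lemma 5.3.7: analytic polyhedra between `K̂` and `U` -/

/-- **Hörmander's Lemma 5.3.7** (data form). Let `M` be holomorphically convex, Hausdorff and
locally compact, `K ⊆ M` compact and `U` an open neighbourhood of `K̂`. Then there are
`f₁, …, f_N ∈ 𝒪(M)` and a compact `W ⊆ U` with `K̂ ⊆ W°` such that `‖f_j‖ < 1` on `K̂` for
all `j` and `{x ∈ W : ‖f_j x‖ ≤ 1 for all j} ⊆ W°` (the polyhedron cut out of `W` by the `f_j`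
does not reach `W ∖ W°`). [cite: HormanderSCV1973, Lemma 5.3.7] -/
theorem IsHolomorphicallyConvex.exists_polyhedron_between [T2Space M] [LocallyCompactSpace M]
    (hM : IsHolomorphicallyConvex E M) {K U : Set M} (hK : IsCompact K) (hU : IsOpen U)
    (hKU : holomorphicHull E M K ⊆ U) :
    ∃ (N : ℕ) (f : Fin N → M → ℂ) (W : Set M),
      (∀ j, MDifferentiable 𝓘(ℂ, E) 𝓘(ℂ, ℂ) (f j)) ∧ IsCompact W ∧ W ⊆ U ∧
      holomorphicHull E M K ⊆ interior W ∧
      (∀ j, ∀ x ∈ holomorphicHull E M K, ‖f j x‖ < 1) ∧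
      {x ∈ W | ∀ j, ‖f j x‖ ≤ 1} ⊆ interior W := by
  classical
  obtain ⟨W, hW, hKW, hWU⟩ := exists_compact_between (hM K hK) hU hKU
  set B : Set M := W \ interior W with hBdef
  have hB : IsCompact B := hW.diff isOpen_interior
  have hsep : ∀ y ∈ B, ∃ g : M → ℂ, MDifferentiable 𝓘(ℂ, E) 𝓘(ℂ, ℂ) g ∧
      (∀ z ∈ holomorphicHull E M K, ‖g z‖ < 1) ∧ 1 < ‖g y‖ := fun y hy =>
    exists_mdifferentiable_norm_lt_one_lt fun h => hy.2 (hKW h)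
  choose! g hg hgK hgy using hsep
  have hopen : ∀ y : B, IsOpen {x | 1 < ‖g y x‖} := fun y =>
    isOpen_lt continuous_const (continuous_norm.comp (hg y y.2).continuous)
  obtain ⟨t, ht⟩ := hB.elim_finite_subcover (fun y : B => {x | 1 < ‖g y x‖}) hopen
    fun x hx => mem_iUnion.2 ⟨⟨x, hx⟩, hgy x hx⟩
  refine ⟨t.card, fun j => g (t.equivFin.symm j : B), W, fun j => hg _ (t.equivFin.symm j).1.2,
    hW, hWU, hKW, fun j x hx => hgK _ (t.equivFin.symm j).1.2 x hx, ?_⟩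
  rintro x ⟨hxW, hx1⟩
  by_contra hxi
  have hxB : x ∈ B := ⟨hxW, hxi⟩
  obtain ⟨y, hy⟩ := mem_iUnion.1 (ht hxB)
  obtain ⟨hyt, hxy⟩ := mem_iUnion.1 hy
  have h1 := hx1 (t.equivFin ⟨y, hyt⟩)
  simp only [Equiv.symm_apply_apply] at h1
  exact (not_lt.2 h1) hxy

omit [ChartedSpace E M] in
/-- The open analytic polyhedron `{x ∈ W° : ‖f_j x‖ < 1 ∀ j}` is open (for continuous `f_j`).
[folklore] -/
theorem isOpen_polyhedron {W : Set M} {N : ℕ} {f : Fin N → M → ℂ} (hf : ∀ j, Continuous (f j)) :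
    IsOpen {x ∈ interior W | ∀ j, ‖f j x‖ < 1} := by
  have : {x ∈ interior W | ∀ j, ‖f j x‖ < 1} = interior W ∩ ⋂ j, {x | ‖f j x‖ < 1} := by
    ext x; simp [mem_iInter]
  rw [this]
  exact isOpen_interior.inter
    (isOpen_iInter_of_finite fun j => isOpen_lt (continuous_norm.comp (hf j)) continuous_const)

omit [ChartedSpace E M] in
/-- The closure of the open polyhedron `{x ∈ W° : ‖f_j x‖ < 1 ∀ j}` lies in the compact
polyhedron `{x ∈ W : ‖f_j x‖ ≤ 1 ∀ j}` (for `W` closed and `f_j` continuous). [folklore] -/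
theorem closure_polyhedron_subset {W : Set M} (hW : IsClosed W) {N : ℕ} {f : Fin N → M → ℂ}
    (hf : ∀ j, Continuous (f j)) :
    closure {x ∈ interior W | ∀ j, ‖f j x‖ < 1} ⊆ {x ∈ W | ∀ j, ‖f j x‖ ≤ 1} := by
  have hcl : IsClosed {x ∈ W | ∀ j, ‖f j x‖ ≤ 1} := by
    have : {x ∈ W | ∀ j, ‖f j x‖ ≤ 1} = W ∩ ⋂ j, {x | ‖f j x‖ ≤ 1} := by
      ext x; simp [mem_iInter]
    rw [this]
    exact hW.inter (isClosed_iInter fun j => isClosed_le (continuous_norm.comp (hf j))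
      continuous_const)
  refine closure_minimal (fun x hx => ⟨interior_subset hx.1, fun j => (hx.2 j).le⟩) hcl

/-- **Analytic polyhedra between `K̂` and `U`** (Hörmander's Lemma 5.3.7, packaged). For `M`
holomorphically convex, Hausdorff, locally compact, `K` compact and `U ⊇ K̂` open: there are
`f₁, …, f_N ∈ 𝒪(M)` and a compact `W ⊆ U` such that the open analytic polyhedron
`P = {x ∈ W° : ‖f_j x‖ < 1 ∀ j}` contains `K̂`, and its closure lies in the compact polyhedron
`{x ∈ W : ‖f_j x‖ ≤ 1 ∀ j} ⊆ W° ⊆ U`. [cite: HormanderSCV1973, Lemma 5.3.7] -/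
theorem IsHolomorphicallyConvex.exists_analyticPolyhedron [T2Space M] [LocallyCompactSpace M]
    (hM : IsHolomorphicallyConvex E M) {K U : Set M} (hK : IsCompact K) (hU : IsOpen U)
    (hKU : holomorphicHull E M K ⊆ U) :
    ∃ (N : ℕ) (f : Fin N → M → ℂ) (W : Set M),
      (∀ j, MDifferentiable 𝓘(ℂ, E) 𝓘(ℂ, ℂ) (f j)) ∧ IsCompact W ∧ W ⊆ U ∧
      IsOpen {x ∈ interior W | ∀ j, ‖f j x‖ < 1} ∧
      holomorphicHull E M K ⊆ {x ∈ interior W | ∀ j, ‖f j x‖ < 1} ∧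
      closure {x ∈ interior W | ∀ j, ‖f j x‖ < 1} ⊆ {x ∈ W | ∀ j, ‖f j x‖ ≤ 1} ∧
      IsCompact {x ∈ W | ∀ j, ‖f j x‖ ≤ 1} ∧
      {x ∈ W | ∀ j, ‖f j x‖ ≤ 1} ⊆ interior W := by
  obtain ⟨N, f, W, hf, hW, hWU, hKW, hfK, hPW⟩ := hM.exists_polyhedron_between hK hU hKU
  have hfc : ∀ j, Continuous (f j) := fun j => (hf j).continuous
  refine ⟨N, f, W, hf, hW, hWU, isOpen_polyhedron hfc, fun x hx => ⟨hKW hx, fun j => hfK j x hx⟩,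
    closure_polyhedron_subset hW.isClosed hfc, ?_, hPW⟩
  have : {x ∈ W | ∀ j, ‖f j x‖ ≤ 1} = W ∩ ⋂ j, {x | ‖f j x‖ ≤ 1} := by
    ext x; simp [mem_iInter]
  rw [this]
  exact hW.inter_right (isClosed_iInter fun j => isClosed_le (continuous_norm.comp (hfc j))
    continuous_const)

/-! ### Exhaustion by `𝒪(M)`-convex compacta -/

/-- **`𝒪(M)`-convex compact exhaustion.** A holomorphically convex, Hausdorff, locally compact,
σ-compact `M` is exhausted by compacta `K₀ ⊆ K₁° ⊆ K₁ ⊆ K₂° ⊆ ⋯`, `⋃ K_n = M`, each of which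
equals its own holomorphically convex hull. [cite: HormanderSCV1973, p. 125 (proof of Thm. 5.3.9: "from (α) in Definition 5.1.3 …")] -/
theorem IsHolomorphicallyConvex.exists_compactExhaustion_holomorphicHull_eq [T2Space M]
    [LocallyCompactSpace M] [SigmaCompactSpace M] (hM : IsHolomorphicallyConvex E M) :
    ∃ K : CompactExhaustion M, ∀ n, holomorphicHull E M (K n) = K n := by
  classical
  let L : CompactExhaustion M := CompactExhaustion.choice M
  have step : ∀ n : ℕ, ∃ m, holomorphicHull E M (L n) ⊆ interior (L m) := fun n => by
    obtain ⟨m, hm⟩ := L.exists_superset_of_isCompact (hM _ (L.isCompact n))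
    exact ⟨m + 1, hm.trans (L.subset_interior_succ m)⟩
  choose φ hφ using step
  let ι : ℕ → ℕ := fun n => Nat.rec 0 (fun k ih => max (k + 1) (φ ih)) n
  have hιs : ∀ k, ι (k + 1) = max (k + 1) (φ (ι k)) := fun k => rfl
  have hιge : ∀ n, n ≤ ι n := fun n => by
    cases n with
    | zero => exact Nat.zero_le _
    | succ k => rw [hιs]; exact le_max_left _ _
  refine ⟨⟨fun n => holomorphicHull E M (L (ι n)), fun n => hM _ (L.isCompact _),
    fun n => ?_, ?_⟩, fun n => holomorphicHull_holomorphicHull _⟩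
  · show holomorphicHull E M (L (ι n)) ⊆ interior (holomorphicHull E M (L (ι (n + 1))))
    refine (hφ (ι n)).trans (interior_mono ?_)
    rw [hιs]
    exact (L.subset (le_max_right _ _)).trans (subset_holomorphicHull _)
  · show ⋃ n, holomorphicHull E M (L (ι n)) = univ
    exact eq_univ_of_forall fun x =>
      mem_iUnion.2 ⟨L.find x, subset_holomorphicHull _ (L.subset (hιge _) (L.mem_find x))⟩

/-! ### Stein manifolds (binder shape of the Oka-principle facts) -/

variable (E M) in
/-- A charted space over a finite-dimensional complex normed space is locally compact.
[folklore] -/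
theorem locallyCompactSpace_of_chartedSpace [FiniteDimensional ℂ E] : LocallyCompactSpace M := by
  haveI : ProperSpace E := FiniteDimensional.proper ℂ E
  exact ChartedSpace.locallyCompactSpace E M

/-- **Hörmander's Lemma 5.3.7 on a Stein manifold** (Fritzsche–Grauert's definition; only
holomorphic convexity is used): analytic polyhedra between `K̂` and any open `U ⊇ K̂`.
[cite: HormanderSCV1973, Lemma 5.3.7] -/
theorem IsSteinManifold.exists_polyhedron_between [FiniteDimensional ℂ E] [T2Space M]
    (h : IsSteinManifold E M) {K U : Set M} (hK : IsCompact K) (hU : IsOpen U)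
    (hKU : holomorphicHull E M K ⊆ U) :
    ∃ (N : ℕ) (f : Fin N → M → ℂ) (W : Set M),
      (∀ j, MDifferentiable 𝓘(ℂ, E) 𝓘(ℂ, ℂ) (f j)) ∧ IsCompact W ∧ W ⊆ U ∧
      holomorphicHull E M K ⊆ interior W ∧
      (∀ j, ∀ x ∈ holomorphicHull E M K, ‖f j x‖ < 1) ∧
      {x ∈ W | ∀ j, ‖f j x‖ ≤ 1} ⊆ interior W := by
  haveI := locallyCompactSpace_of_chartedSpace E M
  exact h.isHolomorphicallyConvex.exists_polyhedron_between hK hU hKU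

/-- Analytic polyhedra between `K̂` and `U` on a Stein manifold, packaged form
(see `IsHolomorphicallyConvex.exists_analyticPolyhedron`). [cite: HormanderSCV1973, Lemma 5.3.7] -/
theorem IsSteinManifold.exists_analyticPolyhedron [FiniteDimensional ℂ E] [T2Space M]
    (h : IsSteinManifold E M) {K U : Set M} (hK : IsCompact K) (hU : IsOpen U)
    (hKU : holomorphicHull E M K ⊆ U) :
    ∃ (N : ℕ) (f : Fin N → M → ℂ) (W : Set M),
      (∀ j, MDifferentiable 𝓘(ℂ, E) 𝓘(ℂ, ℂ) (f j)) ∧ IsCompact W ∧ W ⊆ U ∧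
      IsOpen {x ∈ interior W | ∀ j, ‖f j x‖ < 1} ∧
      holomorphicHull E M K ⊆ {x ∈ interior W | ∀ j, ‖f j x‖ < 1} ∧
      closure {x ∈ interior W | ∀ j, ‖f j x‖ < 1} ⊆ {x ∈ W | ∀ j, ‖f j x‖ ≤ 1} ∧
      IsCompact {x ∈ W | ∀ j, ‖f j x‖ ≤ 1} ∧
      {x ∈ W | ∀ j, ‖f j x‖ ≤ 1} ⊆ interior W := by
  haveI := locallyCompactSpace_of_chartedSpace E M
  exact h.isHolomorphicallyConvex.exists_analyticPolyhedron hK hU hKU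

/-- **`𝒪(M)`-convex compact exhaustion of a Stein manifold** (Fritzsche–Grauert's definition,
`M` Hausdorff with countable basis, charted on a finite-dimensional `E`): compacta
`K₀ ⊆ K₁° ⊆ K₁ ⊆ ⋯` with `⋃ K_n = M` and `K̂_n = K_n` — the exhaustion `W_m` on which
Grauert's induction for the Oka principle runs (Leiterer, SCV IV, Ch. II, 5.3.2).
[cite: HormanderSCV1973, p. 125 (proof of Thm. 5.3.9)] -/
theorem IsSteinManifold.exists_compactExhaustion_holomorphicHull_eq [FiniteDimensional ℂ E]
    [T2Space M] [SecondCountableTopology M] (h : IsSteinManifold E M) :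
    ∃ K : CompactExhaustion M, ∀ n, holomorphicHull E M (K n) = K n := by
  haveI := locallyCompactSpace_of_chartedSpace E M
  haveI : SigmaCompactSpace M := sigmaCompactSpace_of_locallyCompact_secondCountable
  exact h.isHolomorphicallyConvex.exists_compactExhaustion_holomorphicHull_eq

end Literature.Analysis.Complex
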